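import Literature.Computability.QuantumComplexity.SimonOracleSampler
import HarnessLib

/-!
# The `BQP^O` Simon machine for the level encoding, III: running the sampler

Fifth file of the machine behind the hypothesis `SimonLevelMachine` of
`Literature/Barriers/QuantumAdvantage/PPolyOraclesThm76Simon.lean`: the semantics of the Simon
sampler `samplerGates n B' M` of `SimonOracleSampler.lean` on the padded input `|x 0…0⟩`.

* `coEval_nots` — a run of `NOT`s on distinct wires flips exactly those wires;
* `preLabel A x` — the basis label after the classical prefix (input `x`, the constants
  `1^{2n} 0 1 1` / `0` / `1…1`, the announcement bits `[ancStr n i ∈ A]`, registers at `0`) and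
  `coEval_preOps : coEval A preOps |x 0…0⟩ = preLabel A x`;
* `Fbits A u` — the oracle bits `[qryStr n y_β(u) i' ∈ A]` written on the value register — and
  `coEval_midOps : coEval A midOps |e_Y ↦ u, preLabel⟩ = valueState e_Y e_V preLabel (Fbits A) u`
  (copy, query — the wires spell `qryStr`, `map_qryWires` — uncopy);
* **`samplerGates_mulVec_apply`** — the amplitudes of the sampler on `|x 0…0⟩`: at a basis label
  `z`, `[z = preLabel off the y- and value registers] · ∑_{u : Fbits u = z|_V} H(u, 0) H(z|_Y, u)`
  (Simon 1997, §3.1, for all blocks at once).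

## References

* D. R. Simon, SIAM J. Comput. 26 (1997), §3.1 [Simon1997].
* M. A. Nielsen, I. L. Chuang, CUP 2010, §1.4.4, §6.1.1 [NielsenChuang2010].
-/

noncomputable section

namespace Literature.Computability.QuantumComplexity

open Matrix _root_.Computability Complexity Cryptography Finset RevSim RazTalMachine RazTalMachine.RtOp

namespace SimonOracle

variable {n B' M : ℕ}

/-! ### `NOT`s on distinct wires -/

/-- **A run of `NOT`s on distinct wires flips exactly those wires.** [cite: NielsenChuang2010, §1.3.1] -/
theorem coEval_nots {N : ℕ} (A : Language Bool) (ws : List (Fin N)) (hnd : ws.Nodup) (w : QReg N) :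
    coEval A (ws.map fun a => RtOp.cl (ClOp.not a)) w = fun p => if p ∈ ws then !w p else w p := by
  classical
  induction ws generalizing w with
  | nil => funext p; simp
  | cons a ws ih =>
    rw [List.map_cons, coEval_cons, ih (List.nodup_cons.1 hnd).2]
    have hstep : coStep A (RtOp.cl (ClOp.not a)) w = Function.update w a (!w a) := by
      simp [coStep, ClOp.eval, ClOp.target, ClOp.guard]
    rw [hstep]
    funext p
    by_cases hpa : p = a
    · subst hpa
      rw [if_neg (List.nodup_cons.1 hnd).1, if_pos List.mem_cons_self, Function.update_self]
    · rw [Function.update_of_ne hpa]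
      by_cases hp : p ∈ ws
      · rw [if_pos hp, if_pos (List.mem_cons_of_mem _ hp)]
      · rw [if_neg hp, if_neg (by simp [hpa, hp])]

/-! ### Reading wires by their number -/

/-- The padded input off the input wires is `0`. [folklore] -/
theorem padInput_apply_of_le (x : QReg n) {a : Fin (W n B' M)} (ha : n ≤ (a : ℕ)) : padInput x (anc n B' M) a = false := by
  have : a = Fin.natAdd n ⟨(a : ℕ) - n, by have := a.isLt; unfold W at this; omega⟩ := Fin.ext (by simp; omega)
  rw [this, padInput, Fin.append_right]

/-- The padded input on the input wires is `x`. [folklore] -/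
theorem padInput_apply_of_lt (x : QReg n) {a : Fin (W n B' M)} (ha : (a : ℕ) < n) : padInput x (anc n B' M) a = x ⟨a, ha⟩ := by
  have h := Fin.append_left x (fun _ : Fin (anc n B' M) => false) ⟨a, ha⟩
  have e : Fin.castAdd (anc n B' M) ⟨a, ha⟩ = a := Fin.ext rfl
  rw [e] at h
  exact h

/-- Membership in the constant wires, by wire number. [folklore] -/
theorem mem_constWires_iff {a : Fin (W n B' M)} :
    a ∈ constWires n B' M ↔ (∃ p, p ≤ 2 * n + 2 ∧ p ≠ 2 * n ∧ (a : ℕ) = loW n p) ∨ (∃ s, s ≤ B' ∧ (a : ℕ) = hiW n B' (NB B' M) s) := by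
  unfold constWires
  simp only [List.mem_map, List.mem_append, List.mem_filter, List.mem_range, decide_eq_true_eq]
  constructor
  · rintro ⟨q, (⟨p, ⟨hp, hp2⟩, rfl⟩ | ⟨s, hs, rfl⟩), rfl⟩
    · refine Or.inl ⟨p, by omega, hp2, val_foW ?_⟩
      have h1 := loW_lt_cW (n := n) (p := p) (by omega) 0
      have h2 := cW_lt_blkW (n := n) (B' := B') (i := 0) (Nat.zero_le _) (NB B' M)
      rw [W_eq]; unfold Wtot topZ; omega
    · exact Or.inr ⟨s, by omega, val_foW (by rw [W_eq]; exact hiW_lt_Wtot (by omega))⟩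
  · rintro (⟨p, hp, hp2, ha⟩ | ⟨s, hs, ha⟩)
    · refine ⟨loW n p, Or.inl ⟨p, ⟨by omega, hp2⟩, rfl⟩, Fin.ext ?_⟩
      rw [ha]; refine val_foW ?_
      have h1 := loW_lt_cW (n := n) (p := p) (by omega) 0
      have h2 := cW_lt_blkW (n := n) (B' := B') (i := 0) (Nat.zero_le _) (NB B' M)
      rw [W_eq]; unfold Wtot topZ; omega
    · refine ⟨hiW n B' (NB B' M) s, Or.inr ⟨s, by omega, rfl⟩, Fin.ext ?_⟩
      rw [ha]; exact val_foW (by rw [W_eq]; exact hiW_lt_Wtot (by omega))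

/-- The constant wires have no repetition. [folklore] -/
theorem nodup_constWires : (constWires n B' M).Nodup := by
  unfold constWires
  have hlt : ((((List.range (2 * n + 3)).filter fun p => p ≠ 2 * n).map (loW n)) ++
      (List.range (B' + 1)).map (hiW n B' (NB B' M))).Pairwise (· < ·) := by
    rw [List.pairwise_append]
    refine ⟨List.pairwise_map.2 ((List.pairwise_lt_range.filter _).imp fun h => by unfold loW; omega),
      pairwise_lt_map_range _ _ fun a b h => by unfold hiW; omega, ?_⟩
    simp only [List.mem_map, List.mem_filter, List.mem_range]
    rintro _ ⟨p, ⟨hp, -⟩, rfl⟩ _ ⟨s, hs, rfl⟩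
    have h1 := loW_lt_cW (n := n) (p := p) (by omega) 0
    have h2 := cW_lt_blkW (n := n) (B' := B') (i := 0) (Nat.zero_le _) (NB B' M)
    have h3 := topZ_lt_hiW (n := n) (B' := B') (NB := NB B' M) s
    unfold topZ at h3; omega
  have hW : ∀ a ∈ (((List.range (2 * n + 3)).filter fun p => p ≠ 2 * n).map (loW n)) ++
      (List.range (B' + 1)).map (hiW n B' (NB B' M)), a < W n B' M := by
    simp only [List.mem_append, List.mem_map, List.mem_filter, List.mem_range]
    rintro a (⟨p, ⟨hp, -⟩, rfl⟩ | ⟨s, hs, rfl⟩)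
    · have h1 := loW_lt_cW (n := n) (p := p) (by omega) 0
      have h2 := cW_lt_blkW (n := n) (B' := B') (i := 0) (Nat.zero_le _) (NB B' M)
      rw [W_eq]; unfold Wtot topZ; omega
    · rw [W_eq]; exact hiW_lt_Wtot (by omega)
  have hnd : ((((List.range (2 * n + 3)).filter fun p => p ≠ 2 * n).map (loW n)) ++
      (List.range (B' + 1)).map (hiW n B' (NB B' M))).Nodup := hlt.imp fun h => Nat.ne_of_lt h
  exact hnd.map_on fun a ha b hb h => foW_inj (hW a ha) (hW b hb) h

/-! ### The label after the prefix -/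

/-- **The basis label after the classical prefix**, by regions of the wire number: the input `x`;
the low constants `1^{2n} 0 1 1`; the announcement bits `[ancStr n i ∈ A]`, `i ≤ B'`; the
registers and the top zero at `0`; the high ones. [cite: Simon1997, §3.1] -/
def preLabel (A : Language Bool) (x : QReg n) : QReg (W n B' M) := fun a =>
  if h : (a : ℕ) < n then x ⟨a, h⟩
  else if (a : ℕ) ≤ 3 * n + 2 then loBit n ((a : ℕ) - n)
  else if (a : ℕ) ≤ 3 * n + 3 + B' then A.boolIndicator (ancStr n ((a : ℕ) - (3 * n + 3)))
  else if (a : ℕ) ≤ topZ n B' (NB B' M) then false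
  else true

variable (A : Language Bool)

/-- The label after the `NOT`s. [folklore] -/
theorem coEval_notOps (x : QReg n) :
    coEval A (notOps n B' M) (padInput x (anc n B' M)) =
      fun a => if a ∈ constWires n B' M then true else padInput x (anc n B' M) a := by
  rw [notOps, coEval_nots A _ nodup_constWires]
  funext a
  split_ifs with h
  · rw [padInput_apply_of_le x (by
      rcases mem_constWires_iff.1 h with ⟨p, -, -, ha⟩ | ⟨s, -, ha⟩
      · rw [ha]; unfold loW; omega
      · rw [ha]; unfold hiW topZ blkW baseR; omega)]
    rfl
  · rfl

/-- The label after the `NOT`s has the constants set. [folklore] -/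
theorem constsSet_notOps (x : QReg n) :
    ConstsSet n B' (NB B' M) (fun p => coEval A (notOps n B' M) (padInput x (anc n B' M)) (foW n B' M p)) := by
  rw [coEval_notOps]
  have hlo : ∀ p, p ≤ 2 * n + 2 → (foW n B' M (loW n p) : ℕ) = loW n p := fun p hp => val_foW (by
    have h1 := loW_lt_cW (n := n) (p := p) hp 0
    have h2 := cW_lt_blkW (n := n) (B' := B') (i := 0) (Nat.zero_le _) (NB B' M)
    rw [W_eq]; unfold Wtot topZ; omega)
  have htop : (foW n B' M (topZ n B' (NB B' M)) : ℕ) = topZ n B' (NB B' M) := val_foW (by rw [W_eq]; unfold Wtot; omega)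
  have hhi : ∀ s, s ≤ B' → (foW n B' M (hiW n B' (NB B' M) s) : ℕ) = hiW n B' (NB B' M) s := fun s hs =>
    val_foW (by rw [W_eq]; exact hiW_lt_Wtot hs)
  refine ⟨fun p hp => ?_, ?_, fun s hs => ?_⟩
  · simp only
    by_cases hp2 : p = 2 * n
    · subst hp2
      rw [if_neg, padInput_apply_of_le x (by rw [hlo _ hp]; unfold loW; omega)]
      · simp [loBit]
      · intro hmem
        rcases mem_constWires_iff.1 hmem with ⟨p', hp', hp'2, ha⟩ | ⟨s, hs, ha⟩
        · rw [hlo _ hp] at ha; unfold loW at ha; omega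
        · rw [hlo _ hp] at ha; unfold loW hiW topZ blkW baseR at ha; omega
    · rw [if_pos (mem_constWires_iff.2 (Or.inl ⟨p, hp, hp2, hlo p hp⟩))]
      simp [loBit, hp2]
  · simp only
    rw [if_neg, padInput_apply_of_le x (by rw [htop]; unfold topZ blkW baseR; omega)]
    intro hmem
    rcases mem_constWires_iff.1 hmem with ⟨p', hp', -, ha⟩ | ⟨s, hs, ha⟩
    · rw [htop] at ha
      have h1 := loW_lt_cW (n := n) (p := p') hp' 0
      have h2 := cW_lt_blkW (n := n) (B' := B') (i := 0) (Nat.zero_le _) (NB B' M)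
      unfold topZ at ha; omega
    · rw [htop] at ha; unfold hiW at ha; omega
  · simp only
    rw [if_pos (mem_constWires_iff.2 (Or.inr ⟨s, hs, hhi s hs⟩))]


/-! ### The announcement queries -/

/-- Announcement wires lie below `W`. [folklore] -/
theorem cW_lt_W {i : ℕ} (hi : i ≤ B') : cW n i < W n B' M := by
  have := cW_lt_blkW (n := n) (B' := B') hi (NB B' M)
  rw [W_eq]; unfold Wtot topZ; omega

/-- The value of an announcement wire. [folklore] -/
theorem val_foW_cW {i : ℕ} (hi : i ≤ B') : (foW n B' M (cW n i) : ℕ) = cW n i := val_foW (cW_lt_W hi)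

/-- The announcement answer wires are injective. [folklore] -/
theorem foW_cW_injective : Function.Injective fun i : Fin (B' + 1) => foW n B' M (cW n (i : ℕ)) := by
  intro i i' h
  have hi : (i : ℕ) ≤ B' := Nat.lt_succ_iff.1 i.isLt
  have hi' : (i' : ℕ) ≤ B' := Nat.lt_succ_iff.1 i'.isLt
  have h' := foW_inj (cW_lt_W hi) (cW_lt_W hi') h
  unfold cW at h'
  exact Fin.ext (by omega)

/-- No announcement answer wire is queried by an announcement. [folklore] -/
theorem foW_cW_not_mem (c c' : Fin (B' + 1)) :
    foW n B' M (cW n (c : ℕ)) ∉ (ancWires n B' (NB B' M) (c' : ℕ)).map (foW n B' M) := by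
  have hc : (c : ℕ) ≤ B' := Nat.lt_succ_iff.1 c.isLt
  have hc' : (c' : ℕ) ≤ B' := Nat.lt_succ_iff.1 c'.isLt
  intro h
  obtain ⟨a, ha, e⟩ := List.mem_map.1 h
  have := foW_inj (W_eq (n := n) (B' := B') (M := M) ▸ lt_Wtot_of_mem_ancWires hc' ha) (cW_lt_W hc) e
  exact cW_not_mem_ancWires hc (this ▸ ha)

/-- **The label after the classical prefix is `preLabel A x`.** [cite: Simon1997, §3.1] -/
theorem coEval_preOps (x : QReg n) : coEval A (preOps n B' M) (padInput x (anc n B' M)) = preLabel A x := by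
  classical
  rw [preOps, coEval_append]
  set s₁ := coEval A (notOps n B' M) (padInput x (anc n B' M)) with hs₁
  have hcs : ConstsSet n B' (NB B' M) (fun p => s₁ (foW n B' M p)) := constsSet_notOps A x
  have hs₁v : ∀ a : Fin (W n B' M), s₁ a = if a ∈ constWires n B' M then true else padInput x (anc n B' M) a := by
    intro a; rw [hs₁, coEval_notOps]
  have hq := coEval_queries A (fun c : Fin (B' + 1) => (ancWires n B' (NB B' M) (c : ℕ)).map (foW n B' M))
    (fun c : Fin (B' + 1) => foW n B' M (cW n (c : ℕ))) foW_cW_injective foW_cW_not_mem s₁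
  rw [show ancOps n B' M = (List.finRange (B' + 1)).map (fun c : Fin (B' + 1) =>
      RtOp.oracle ((ancWires n B' (NB B' M) (c : ℕ)).map (foW n B' M)) (foW n B' M (cW n (c : ℕ)))) from rfl, hq]
  funext a
  have haW : (a : ℕ) < topZ n B' (NB B' M) + 2 + B' := by
    have h := a.isLt
    have e := W_eq (n := n) (B' := B') (M := M)
    unfold Wtot at e; omega
  -- is `a` an announcement answer wire?
  by_cases hc : ∃ c : Fin (B' + 1), foW n B' M (cW n (c : ℕ)) = a
  · obtain ⟨c, hca⟩ := hc
    have hcB : (c : ℕ) ≤ B' := Nat.lt_succ_iff.1 c.isLt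
    have hex : ∃ c : Fin (B' + 1), (fun c : Fin (B' + 1) => foW n B' M (cW n (c : ℕ))) c = a := ⟨c, hca⟩
    rw [dif_pos hex]
    have hch : hex.choose = c := foW_cW_injective (hex.choose_spec.trans hca.symm)
    rw [hch]
    have hav : (a : ℕ) = cW n c := by rw [← hca, val_foW_cW hcB]
    -- `s₁ a = false`
    have hs₁a : s₁ a = false := by
      rw [hs₁v, if_neg, padInput_apply_of_le x (by rw [hav]; unfold cW; omega)]
      intro hmem
      rcases mem_constWires_iff.1 hmem with ⟨p, hp, -, ha⟩ | ⟨s, hs, ha⟩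
      · rw [hav] at ha; unfold cW loW at ha; omega
      · rw [hav] at ha
        have := cW_lt_blkW (n := n) (B' := B') hcB (NB B' M)
        unfold hiW topZ at ha; omega
    rw [hs₁a, Bool.false_xor, List.map_map]
    rw [show ((fun p => s₁ p) ∘ foW n B' M) = fun p => s₁ (foW n B' M p) from rfl, map_ancWires hcs hcB]
    -- the closed form
    unfold preLabel
    have h1 : ¬ (a : ℕ) < n := by rw [hav]; unfold cW; omega
    have h2 : ¬ (a : ℕ) ≤ 3 * n + 2 := by rw [hav]; unfold cW; omega
    have h3 : (a : ℕ) ≤ 3 * n + 3 + B' := by rw [hav]; unfold cW; omega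
    rw [dif_neg h1, if_neg h2, if_pos h3]
    congr 2
    rw [hav]; unfold cW; omega
  · rw [dif_neg hc, hs₁v]
    unfold preLabel
    by_cases h1 : (a : ℕ) < n
    · rw [dif_pos h1, if_neg, padInput_apply_of_lt x h1]
      intro hmem
      rcases mem_constWires_iff.1 hmem with ⟨p, -, -, ha⟩ | ⟨s, -, ha⟩
      · unfold loW at ha; omega
      · unfold hiW topZ blkW baseR at ha; omega
    rw [dif_neg h1]
    by_cases h2 : (a : ℕ) ≤ 3 * n + 2
    · rw [if_pos h2]
      have hap : (a : ℕ) = loW n ((a : ℕ) - n) := by unfold loW; omega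
      by_cases hp2 : (a : ℕ) - n = 2 * n
      · rw [if_neg, padInput_apply_of_le x (by omega)]
        · simp [loBit, hp2]
        · intro hmem
          rcases mem_constWires_iff.1 hmem with ⟨p, hp, hp', ha⟩ | ⟨s, -, ha⟩
          · unfold loW at ha; omega
          · unfold hiW topZ blkW baseR at ha; omega
      · rw [if_pos (mem_constWires_iff.2 (Or.inl ⟨(a : ℕ) - n, by omega, hp2, hap⟩))]
        simp [loBit, hp2]
    rw [if_neg h2]
    by_cases h3 : (a : ℕ) ≤ 3 * n + 3 + B'
    · -- an announcement wire after all
      exfalso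
      refine hc ⟨⟨(a : ℕ) - (3 * n + 3), by omega⟩, Fin.ext ?_⟩
      rw [val_foW_cW (by simp; omega)]
      simp only; unfold cW; omega
    rw [if_neg h3]
    by_cases h4 : (a : ℕ) ≤ topZ n B' (NB B' M)
    · rw [if_pos h4, if_neg, padInput_apply_of_le x (by omega)]
      intro hmem
      rcases mem_constWires_iff.1 hmem with ⟨p, hp, -, ha⟩ | ⟨s, -, ha⟩
      · unfold loW at ha; omega
      · unfold hiW at ha; omega
    · rw [if_neg h4, if_pos (mem_constWires_iff.2 (Or.inr ⟨(a : ℕ) - (topZ n B' (NB B' M) + 1), by omega, by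
        unfold hiW; omega⟩))]

/-- **The registers and the top zero are `0` after the prefix.** [folklore] -/
theorem preLabel_eq_false {x : QReg n} {a : Fin (W n B' M)} (h1 : baseR n B' ≤ (a : ℕ)) (h2 : (a : ℕ) ≤ topZ n B' (NB B' M)) :
    preLabel (M := M) A x a = false := by
  unfold preLabel
  unfold baseR at h1
  rw [dif_neg (by omega), if_neg (by omega), if_neg (by omega), if_pos h2]

/-- The `y`-wires are `0` after the prefix. [folklore] -/
theorem preLabel_eY (x : QReg n) (k : Fin (Y B' M)) : preLabel A x (eY n B' M k) = false :=
  preLabel_eq_false A (by rw [val_eY]; unfold pairW blkW; omega) (by rw [val_eY]; exact (pairW_lt_topZ (blkOf k).isLt (posOf_lt_B' k) (by norm_num)).le)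

/-- The copy wires are `0` after the prefix. [folklore] -/
theorem preLabel_eY' (x : QReg n) (k : Fin (Y B' M)) : preLabel A x (eY' n B' M k) = false :=
  preLabel_eq_false A (by rw [val_eY']; unfold pairW blkW; omega) (by rw [val_eY']; exact (pairW_lt_topZ (blkOf k).isLt (posOf_lt_B' k) (by norm_num)).le)

/-- The value wires are `0` after the prefix. [folklore] -/
theorem preLabel_eV (x : QReg n) (k : Fin (Y B' M)) : preLabel A x (eV n B' M k) = false :=
  preLabel_eq_false A (by rw [val_eV]; unfold valW blkW; omega) (by rw [val_eV]; exact (valW_lt_topZ (blkOf k).isLt (posOf_lt_B' k)).le)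

/-- The label after the prefix has the constants set. [folklore] -/
theorem constsSet_preLabel (x : QReg n) : ConstsSet n B' (NB B' M) (fun p => preLabel (M := M) A x (foW n B' M p)) := by
  have h := constsSet_notOps (B' := B') (M := M) A x
  -- the announcement stage does not touch the constant wires: read them off `coEval_preOps`
  have key : ∀ p, (p ≤ 3 * n + 2 ∨ p = topZ n B' (NB B' M) ∨ ∃ s, s ≤ B' ∧ p = hiW n B' (NB B' M) s) →
      preLabel (M := M) A x (foW n B' M p) = coEval A (notOps n B' M) (padInput x (anc n B' M)) (foW n B' M p) := by
    intro p hp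
    rw [← coEval_preOps A x, preOps, coEval_append]
    refine coEval_apply_of_forall_ne A _ _ fun op hop => ?_
    obtain ⟨c, -, rfl⟩ := List.mem_map.1 hop
    have hcB : (c : ℕ) ≤ B' := Nat.lt_succ_iff.1 c.isLt
    simp only [RtOp.tgt, ne_eq, Option.some.injEq]
    intro h
    have hv := congrArg Fin.val h
    rw [val_foW_cW hcB] at hv
    rcases hp with hp | rfl | ⟨s, hs, rfl⟩
    · rw [val_foW (by rw [W_eq]; unfold Wtot topZ blkW baseR; omega)] at hv
      unfold cW at hv; omega
    · rw [val_foW (by rw [W_eq]; unfold Wtot; omega)] at hv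
      have := cW_lt_blkW (n := n) (B' := B') hcB (NB B' M); unfold topZ at hv; omega
    · rw [val_foW (by rw [W_eq]; exact hiW_lt_Wtot hs)] at hv
      have := cW_lt_blkW (n := n) (B' := B') hcB (NB B' M); unfold hiW topZ at hv; omega
  refine ⟨fun p hp => ?_, ?_, fun s hs => ?_⟩
  · rw [key (loW n p) (Or.inl (by unfold loW; omega))]; exact h.lo p hp
  · rw [key _ (Or.inr (Or.inl rfl))]; exact h.top
  · rw [key _ (Or.inr (Or.inr ⟨s, hs, rfl⟩))]; exact h.hi s hs

/-! ### The middle segment: copy, query, uncopy -/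

/-- The contents of block `β` of the `y`-register `u`, as a bit list. [folklore] -/
def yBlk (u : QReg (Y B' M)) (β : Fin (NB B' M)) : List Bool := List.ofFn fun t : Fin (len M β) => u (yIdx β t)

/-- The length of a block. [folklore] -/
@[simp] theorem length_yBlk (u : QReg (Y B' M)) (β : Fin (NB B' M)) : (yBlk u β).length = len M β := by simp [yBlk]

/-- **The oracle bits written on the value register**: value wire `k` (block `β = blkOf k`, bit
`i' = posOf k`) receives `[qryStr n y_β i' ∈ A]`. [cite: Simon1997, §3.1] [cite: AaronsonChen2017, Thm. 7.6 (proof, p. 30)] -/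
def Fbits (n : ℕ) (A : Language Bool) (u : QReg (Y B' M)) : QReg (Y B' M) := fun k =>
  A.boolIndicator (qryStr n (yBlk u (blkOf k)) (posOf k))

/-- A value wire is not among the query wires of any value query (`j ≤ B'`). [folklore] -/
theorem valW_not_mem_qryWires' {β t β' j i' : ℕ} (hβ : β < NB B' M) (ht : t < B') (hj : j ≤ B') :
    valW n B' β t ∉ qryWires n B' (NB B' M) β' j i' := by
  unfold qryWires
  simp only [List.mem_append, List.mem_map, List.mem_range, List.mem_cons, List.not_mem_nil, or_false, not_or,
    not_exists, not_and]
  refine ⟨⟨⟨fun p hp h => ?_, fun m hm h => ?_⟩, fun h => ?_, fun h => ?_⟩, fun s hs h => ?_⟩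
  · have h1 := loW_lt_cW (n := n) (p := p) (by omega) 0
    have h2 := cW_lt_blkW (n := n) (B' := B') (i := 0) (Nat.zero_le _) β
    unfold valW at h; omega
  · obtain ⟨-, h2⟩ := blkW_add_inj (B' := B') (m := m) (m' := 2 * B' + t) (by omega) (by omega) h
    omega
  · exact absurd h (valW_lt_topZ hβ ht).ne
  · have := valW_lt_topZ (n := n) hβ ht; unfold hiW at h; omega
  · have := valW_lt_topZ (n := n) hβ ht; unfold hiW at h; omega

/-- No value wire is queried. [folklore] -/
theorem eV_not_mem_qsOf (c c' : Fin (Y B' M)) : eV n B' M c ∉ qsOf n c' := by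
  intro h
  obtain ⟨a, ha, e⟩ := List.mem_map.1 h
  have haW : a < W n B' M := W_eq (n := n) (B' := B') (M := M) ▸
    lt_Wtot_of_mem_qryWires (blkOf c').isLt (len_le (blkOf c').isLt) (posOf_lt_B' c').le ha
  have := foW_inj haW (valW_lt_W c) e
  exact valW_not_mem_qryWires' (blkOf c).isLt (posOf_lt_B' c) (len_le (blkOf c').isLt) (this ▸ ha)

/-- Constant and top wires (by number `q`) are no pair wires. [folklore] -/
theorem foW_const_ne_pairE {q r : ℕ} (hr : r < 2) (k : Fin (Y B' M))
    (hq : q ≤ 3 * n + 2 ∨ q = topZ n B' (NB B' M) ∨ ∃ s, s ≤ B' ∧ q = hiW n B' (NB B' M) s) :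
    foW n B' M q ≠ pairEmb n r hr k := by
  intro h
  have hv := congrArg Fin.val h
  have hk := pairW_lt_topZ (n := n) (blkOf k).isLt (posOf_lt_B' k) hr
  have hW : topZ n B' (NB B' M) + 2 + B' = W n B' M := by rw [W_eq]; rfl
  rw [show (pairEmb n r hr k : ℕ) = pairW n B' (blkOf k) (posOf k) r from val_foW (by omega)] at hv
  have hlow : baseR n B' ≤ pairW n B' (blkOf k) (posOf k) r := by unfold pairW blkW; omega
  rcases hq with hq | rfl | ⟨s, hs, rfl⟩
  · rw [val_foW (by unfold topZ blkW baseR at hW; omega)] at hv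
    unfold baseR at hlow; omega
  · rw [val_foW (by omega)] at hv
    omega
  · rw [val_foW (by unfold hiW; omega)] at hv
    unfold hiW at hv; omega

/-- The `y`-wire of block `β`, position `t`, by number. [folklore] -/
theorem foW_pairW_zero (β : Fin (NB B' M)) (t : Fin (len M β)) :
    foW n B' M (pairW n B' β t 0) = eY n B' M (yIdx β t) := by
  apply Fin.ext
  rw [val_eY, blkOf_yIdx, posOf_yIdx]
  exact val_foW ((pairW_lt_topZ β.isLt (t.isLt.trans_le (len_le β.isLt)) (by norm_num)).trans
    (by rw [W_eq]; unfold Wtot; omega))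

/-- The copy wire of block `β`, position `t`, by number. [folklore] -/
theorem foW_pairW_one (β : Fin (NB B' M)) (t : Fin (len M β)) :
    foW n B' M (pairW n B' β t 1) = eY' n B' M (yIdx β t) := by
  apply Fin.ext
  rw [val_eY', blkOf_yIdx, posOf_yIdx]
  exact val_foW ((pairW_lt_topZ β.isLt (t.isLt.trans_le (len_le β.isLt)) (by norm_num)).trans
    (by rw [W_eq]; unfold Wtot; omega))

/-- **The middle segment writes the oracle bits on the value register** and restores the copy
register: `coEval A midOps |e_Y ↦ u, preLabel⟩ = valueState e_Y e_V preLabel (Fbits A) u`.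
[cite: Simon1997, §3.1] [cite: NielsenChuang2010, §6.1.1] -/
theorem coEval_midOps (x : QReg n) (u : QReg (Y B' M)) :
    coEval A (midOps n B' M) (Function.extend (eY n B' M) u (preLabel A x)) =
      valueState (eY n B' M) (eV n B' M) (preLabel A x) (Fbits n A) u := by
  classical
  set w₀ : QReg (W n B' M) := preLabel A x with hw₀
  set sa := Function.extend (eY n B' M) u w₀ with hsa
  -- values of `sa`
  have sa_eY : ∀ j, sa (eY n B' M j) = u j := fun j => (eY n B' M).injective.extend_apply _ _ j
  have sa_off : ∀ p, p ∉ Set.range (eY n B' M) → sa p = w₀ p := fun p hp => extend_apply_of_not_mem _ _ _ hp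
  have hY'Y : ∀ j, (eY' n B' M j) ∉ Set.range (eY n B' M) := fun j ⟨i, hi⟩ => eY_ne_eY' i j hi
  have hVY : ∀ k, (eV n B' M k) ∉ Set.range (eY n B' M) := fun k ⟨i, hi⟩ => eY_ne_eV i k hi
  have hVY' : ∀ k, (eV n B' M k) ∉ Set.range (eY' n B' M) := fun k ⟨i, hi⟩ => eY'_ne_eV i k hi
  have hYY' : ∀ j, (eY n B' M j) ∉ Set.range (eY' n B' M) := fun j ⟨i, hi⟩ => eY_ne_eY' j i hi.symm
  have hYV : ∀ j, (eY n B' M j) ∉ Set.range (eV n B' M) := fun j ⟨i, hi⟩ => eY_ne_eV j i hi.symm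
  have hY'V : ∀ j, (eY' n B' M j) ∉ Set.range (eV n B' M) := fun j ⟨i, hi⟩ => eY'_ne_eV j i hi.symm
  -- stage b: copies
  have hcopy := coEval_copies A (eY n B' M) (eY' n B' M) (eY' n B' M).injective (fun i j => eY_ne_eY' i j)
  rw [midOps, coEval_append, copyOps, hcopy sa]
  set sb : QReg (W n B' M) := fun p => if h : ∃ j, eY' n B' M j = p then sa p ^^ sa (eY n B' M h.choose) else sa p with hsb
  have sb_eY' : ∀ j, sb (eY' n B' M j) = u j := by
    intro j
    have hex : ∃ j', eY' n B' M j' = eY' n B' M j := ⟨j, rfl⟩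
    have hch : hex.choose = j := (eY' n B' M).injective hex.choose_spec
    simp only [hsb]
    rw [dif_pos hex, hch, sa_eY, sa_off _ (hY'Y j), hw₀, preLabel_eY', Bool.false_xor]
  have sb_off : ∀ p, p ∉ Set.range (eY' n B' M) → sb p = sa p := by
    intro p hp
    simp only [hsb]
    rw [dif_neg (fun ⟨j, hj⟩ => hp ⟨j, hj⟩)]
  have sb_eY : ∀ j, sb (eY n B' M j) = u j := fun j => by rw [sb_off _ (hYY' j), sa_eY]
  -- the constants and the copies seen by the queries
  have hcs : ConstsSet n B' (NB B' M) (fun p => sb (foW n B' M p)) := by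
    have h0 := constsSet_preLabel (B' := B') (M := M) A x
    have hconst : ∀ q, (q ≤ 3 * n + 2 ∨ q = topZ n B' (NB B' M) ∨ ∃ s, s ≤ B' ∧ q = hiW n B' (NB B' M) s) →
        sb (foW n B' M q) = w₀ (foW n B' M q) := by
      intro q hq
      rw [sb_off _ (fun ⟨j, hj⟩ => foW_const_ne_pairE (by norm_num) j hq hj.symm),
        sa_off _ (fun ⟨j, hj⟩ => foW_const_ne_pairE (by norm_num) j hq hj.symm)]
    refine ⟨fun p hp => ?_, ?_, fun s hs => ?_⟩
    · rw [hconst (loW n p) (Or.inl (by unfold loW; omega))]; exact h0.lo p hp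
    · rw [hconst _ (Or.inr (Or.inl rfl))]; exact h0.top
    · rw [hconst _ (Or.inr (Or.inr ⟨s, hs, rfl⟩))]; exact h0.hi s hs
  have hpair : ∀ (β : Fin (NB B' M)) (t : ℕ), t < len M β → sb (foW n B' M (pairW n B' β t 1)) = sb (foW n B' M (pairW n B' β t 0)) := by
    intro β t ht
    rw [foW_pairW_one β ⟨t, ht⟩, foW_pairW_zero β ⟨t, ht⟩, sb_eY', sb_eY]
  have hyOf : ∀ β : Fin (NB B' M), yOf n B' (fun p => sb (foW n B' M p)) β (len M β) = yBlk u β := by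
    intro β
    apply List.ext_getElem (by simp)
    intro t h1 h2
    simp only [yOf, yBlk, List.getElem_map, List.getElem_range, List.getElem_ofFn]
    rw [length_yOf] at h1
    rw [foW_pairW_zero β ⟨t, h1⟩, sb_eY]
  -- stage c: queries
  have hqry := coEval_queries A (qsOf n (B' := B') (M := M)) (eV n B' M) (eV n B' M).injective eV_not_mem_qsOf
  rw [coEval_append, qryOps, hqry sb]
  set sc : QReg (W n B' M) := fun p => if h : ∃ c, eV n B' M c = p then
    sb p ^^ A.boolIndicator ((qsOf n h.choose).map sb) else sb p with hsc
  have sc_eV : ∀ k, sc (eV n B' M k) = Fbits n A u k := by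
    intro k
    have hex : ∃ c, eV n B' M c = eV n B' M k := ⟨k, rfl⟩
    have hch : hex.choose = k := (eV n B' M).injective hex.choose_spec
    simp only [hsc]
    rw [dif_pos hex, hch, sb_off _ (hVY' k), sa_off _ (hVY k), hw₀, preLabel_eV, Bool.false_xor, qsOf, List.map_map,
      show (sb ∘ foW n B' M) = fun p => sb (foW n B' M p) from rfl,
      map_qryWires hcs (posOf_lt_B' k).le (hpair (blkOf k)), hyOf]
    rfl
  have sc_off : ∀ p, p ∉ Set.range (eV n B' M) → sc p = sb p := by
    intro p hp
    simp only [hsc]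
    rw [dif_neg (fun ⟨c, hc⟩ => hp ⟨c, hc⟩)]
  -- stage d: uncopies
  rw [hcopy sc]
  funext p
  by_cases hpY' : ∃ j, eY' n B' M j = p
  · obtain ⟨j, rfl⟩ := hpY'
    have hex : ∃ j', eY' n B' M j' = eY' n B' M j := ⟨j, rfl⟩
    have hch : hex.choose = j := (eY' n B' M).injective hex.choose_spec
    rw [dif_pos hex, hch, sc_off _ (hY'V j), sc_off _ (hYV j), sb_eY', sb_eY, Bool.xor_self,
      valueState_of_not_mem _ _ _ (hY'Y j) (hY'V j), hw₀, preLabel_eY']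
  · rw [dif_neg hpY']
    have hpY'r : p ∉ Set.range (eY' n B' M) := fun ⟨j, hj⟩ => hpY' ⟨j, hj⟩
    by_cases hpV : p ∈ Set.range (eV n B' M)
    · obtain ⟨k, rfl⟩ := hpV
      rw [sc_eV, valueState_eV]
    rw [sc_off _ hpV, sb_off _ hpY'r]
    by_cases hpY : p ∈ Set.range (eY n B' M)
    · obtain ⟨j, rfl⟩ := hpY
      rw [sa_eY, show valueState (eY n B' M) (eV n B' M) w₀ (Fbits n A) u (eY n B' M j) =
        (valueState (eY n B' M) (eV n B' M) w₀ (Fbits n A) u ∘ eY n B' M) j from rfl,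
        valueState_comp_e (fun i j => eY_ne_eV i j)]
    · rw [sa_off _ hpY, valueState_of_not_mem _ _ _ hpY hpV]

/-! ### The amplitudes of the sampler -/

/-- The `y`-register is `0` after the prefix. [folklore] -/
theorem preLabel_comp_eY (x : QReg n) : preLabel A x ∘ eY n B' M = fun _ => false :=
  funext fun k => preLabel_eY A x k

/-- **The amplitudes of the Simon sampler on `|x 0…0⟩`** (all blocks at once): at the basis label
`z`, zero unless `z` agrees with `preLabel A x` off the `y`- and value registers (constants,
announcement bits, copy register back at `0`), and then Simon's Fourier-twice sum
`∑_{u : Fbits u = z|_V} H^{⊗Y}(u, 0) · H^{⊗Y}(z|_Y, u)`. [cite: Simon1997, §3.1] [cite: NielsenChuang2010, §1.4.4 and §6.1.1] -/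
theorem samplerGates_mulVec_apply (x : QReg n) (z : QReg (W n B' M)) :
    ((⟨samplerGates n B' M⟩ : QCircuit cliffordT (W n B' M)).toMatrix A *ᵥ basisState (padInput x (anc n B' M))) z =
      if (∀ i, i ∉ Set.range (eY n B' M) → i ∉ Set.range (eV n B' M) → preLabel A x i = z i) then
        ∑ u : QReg (Y B' M), (if Fbits n A u = z ∘ eV n B' M then
          hGateAll (Y B' M) u (fun _ => false) * hGateAll (Y B' M) (z ∘ eY n B' M) u else 0)
      else 0 := by
  rw [samplerGates, toMatrix_mk_append, ← Matrix.mulVec_mulVec,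
    compileList_mulVec_basisState_of_isCO A _ preOps_wf preOps_isCO, coEval_preOps]
  have h0 : basisState (preLabel (B' := B') (M := M) A x) =
      basisState (Function.extend (eY n B' M) (fun _ => false) (preLabel A x)) := by
    rw [← preLabel_comp_eY A x, extend_comp_self]
  rw [h0]
  exact sandwich_value_apply A (fun i j => eY_ne_eV i j) (preLabel A x) (Fbits n A)
    (RtOp.compileList (midOps n B' M) midOps_wf)
    (fun u => by rw [compileList_mulVec_basisState_of_isCO A _ midOps_wf midOps_isCO, coEval_midOps]) _ z
end SimonOracle

end Literature.Computability.QuantumComplexity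

end
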